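import Literature.MathematicalPhysics.QuantumFieldTheory.Balaban1983to89.B15Sect1InstancesB
import Literature.MathematicalPhysics.QuantumFieldTheory.Balaban1983to89.B15DeterminingSetsBBackgroundsBridges

/-!
# `Balaban1983to89.B15Sect1InstancesBBridges` — [Balaban1989LargeFieldI] (= [B15]) §1 instances (1.74), (1.75), Prop. 1, (1.79) OVER `(bg : DetBackgroundB, bd)`: THE THEOREMS
# (THEOREMS-ONLY companion of the statement-only module `B15Sect1InstancesB`)

statement-level skeleton of published theorems with citation tags; proofs where landed; nothing here is a claim about the
Yang–Mills mass gap

Cell `pub-ymgap` (HUMAN RULINGS D-0062 ∕ D-0149), lane `pub-ymgap-dag-n12-c` g34 (R134 seat (a), N12 = [B15], s1); `--kind proof --supports` K1⁹ `stmt-QuantumFields-27364`;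
count-neutral.  THEOREMS ONLY (0 `def`, 0 `instance`, 0 `sorry`).  HONESTY GUARD (director-ym №338 (5)): purely additive; the (b)-instance theorems of `B15Sect1Instances`
(`isMinimizer_bgKZstd`, `chi175std_iff`, `wilsonAction4_bgU0std_le`, `chi175std_of_isVLambdaStd`) stay landed and true on their own text; nothing elsewhere is edited.

WHAT IS HERE.
* §1 `lamDatumP_subset_genSetDatumP` (print's family ⊆ reading (b)'s, levelwise — F0a); `isMinimizerB_bgKZstdB` (the [III] (2.12) property of (1.74) on `bg.dom`, the ONE carrier-side read
  of `bg.isMinimizer`, twin of `isMinimizer_bgKZstd` :83); `chi175stdB_iff` ((1.75) unfolded); `wilsonAction4_bgU0stdB_le` ((1.79) + Prop. 1); `chi175stdB_of_isVLambdaStdB` (a minimiser is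
  its own admissible extension for (1.75)).
* §2 PRINT vs (b) at `Z`'s maximal sequence: `fun177stdB_lamDatumP_le_genSetDatumP` — the function (1.77) built on print's [II] (2.3) datum is pointwise AT MOST the one built on reading
  (b)'s datum (same solution map, data in both domains): the only general comparison between the two roads (FLAG №16: they differ in general).

HONEST SCOPE.  Elementary bookkeeping; nothing of Bałaban's analysis asserted or proved; no named fact inhabited; count-neutral; N12 NOT discharged; K0⁷ ∕ K1⁹ NOT closed; the
Yang–Mills mass gap (Clay) is NOT proved by any of this.

References: [B15] = [Balaban1989LargeFieldI] (1.74) p.192, (1.75) p.193, (1.77)–(1.78) Prop. 1 p.194, (1.79) p.195; [III] = [Balaban1988Convergent] (2.2) p.255, (2.10)–(2.13)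
pp.256–257; [II] = [Balaban1984PropagatorsII] (2.3) p.224; [I] = [Balaban1987RG1] (0.1) p.251.
-/

noncomputable section

namespace Literature.MathematicalPhysics.QuantumFieldTheory.Balaban1983to89.B15Sect1Instances

open Literature.MathematicalPhysics.QuantumFieldTheory.Balaban1983to89
open B15DeterminingSets B15DeterminingSetsB B14.Eq213DetSet B14.Eq216Concrete B15.PrelimIntegrations B15Chi124DetSets B8Eq17ClassAkV1 GaugeField
open Literature.MathematicalPhysics.QuantumFieldTheory.BalabanImbrieJaffe1984to88.BIJ85Eq453GaugeField
open Set

variable {P : Params}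

/-! ## §1  The (2.12) property of (1.74), (1.75) unfolded, (1.79) + Prop. 1, over `(bg, bd)` -/

section TheoremsB

/-- Print's family is contained in reading (b)'s, levelwise (F0a `lamBondsSeq_subset_bondsDet`): inward connectors are dropped, nothing is added.
[cite: Balaban1984PropagatorsII, (2.3) p.224; Balaban1987RG1, (0.1) p.251] -/
theorem lamDatumP_subset_genSetDatumP (k : ℕ) (Ω : ℕ → Set (Site P 0)) (j : ℕ) : (lamDatumP k Ω : BDetSet P) j ⊆ (genSetDatumP k Ω : BDetSet P) j :=
  lamBondsSeq_subset_bondsDet Ω k j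

variable {G : Type*} [GaugeGroup G] {av : ∀ j, Averaging P j G} (bg : DetBackgroundB P G av) (M₁ : ℕ) (bd : ℕ → (ℕ → Set (Site P 0)) → BDetSet P)

/-- **`U_{k,Z}(V_k)` IS A MINIMAL CONFIGURATION of the [III] (2.12) problem for the bond datum `bd k {Ω_j(Z)}` and the data `M˙(Q_k^{s*}V_k)`** (data in the domain of the solution map) —
twin of `isMinimizer_bgKZstd`, the one carrier-side read of `bg.isMinimizer`. [cite: Balaban1989LargeFieldI, (1.74) p.192; Balaban1988Convergent, (2.12) p.256] -/
theorem isMinimizerB_bgKZstdB {Z : Set (Site P 0)} {k : ℕ} {Vk : GaugeField P k G} (hV : avgFamily av (qsstarGIter0 k Vk) ∈ bg.dom (bd k (maxDomT M₁ Z))) :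
    IsMinimizerB av bg.reg (bd k (maxDomT M₁ Z)) (avgFamily av (qsstarGIter0 k Vk)) (bgKZstdB bg M₁ bd Z k Vk) :=
  isMinimizerB_bgKZB hV

variable (Z Λ : Set (Site P 0)) (k : ℕ)

/-- (1.75) unfolded over `(bg, bd)`: SOME extension `W` of `V_k↾_{Z∩Λ^c}` has `|U_{k,Z}(W)(∂p) − 1| < 2ε_kη²` for every plaquette meeting `Ω^c_k` (twin of `chi175std_iff`).
[cite: Balaban1989LargeFieldI, (1.75) p.193] -/
theorem chi175stdB_iff (Ω : ℕ → Set (Site P 0)) (εk η : ℝ) (Vk : GaugeField P k G) :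
    chi175stdB bg M₁ bd Z Λ k Ω εk η Vk ↔
      ∃ W : GaugeField P k G, (∀ b, b ∉ bondsOf (pts k Λ) → W b = Vk b) ∧
        PlaqSmallOn (plaqsOf (Ω k)ᶜ) (2 * εk * η ^ 2) (bgKZstdB bg M₁ bd Z k W) := by
  constructor
  · rintro ⟨W, hW⟩
    exact ⟨W.1, W.2, hW⟩
  · rintro ⟨W, hWb, hW⟩
    exact ⟨⟨W, hWb⟩, hW⟩

/-- (1.79) with Proposition 1, over `(bg, bd)`: `A(U₀)` is the minimum of (1.77) over the fields agreeing with `V_k` off `Λ` (twin of `wilsonAction4_bgU0std_le`).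
[cite: Balaban1989LargeFieldI, (1.79) p.195] -/
theorem wilsonAction4_bgU0stdB_le {Vout VΛ : GaugeField P k G} (hV : IsVLambdaStdB bg M₁ bd Z Λ k Vout VΛ) (W : GaugeField P k G)
    (hW : ∀ b, b ∉ bondsOf (pts k Λ) → W b = Vout b) : wilsonAction4 (bgU0stdB bg M₁ bd Z k VΛ) ≤ fun177stdB bg M₁ bd Z k W :=
  wilsonAction4_bgU0B_le hV W hW

/-- A minimiser is its own admissible extension for (1.75), over `(bg, bd)` (twin of `chi175std_of_isVLambdaStd`). [cite: Balaban1989LargeFieldI, (1.75) p.193, (1.79) p.195] -/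
theorem chi175stdB_of_isVLambdaStdB (Ω : ℕ → Set (Site P 0)) {εk η : ℝ} {Vout VΛ : GaugeField P k G} (hV : IsVLambdaStdB bg M₁ bd Z Λ k Vout VΛ)
    (hU0 : PlaqSmallOn (plaqsOf (Ω k)ᶜ) (2 * εk * η ^ 2) (bgU0stdB bg M₁ bd Z k VΛ)) : chi175stdB bg M₁ bd Z Λ k Ω εk η Vout :=
  (chi175stdB_iff bg M₁ bd Z Λ k Ω εk η Vout).2 ⟨VΛ, hV.1, hU0⟩

end TheoremsB

/-! ## §2  Print's datum vs reading (b) at `Z`'s maximal sequence: the one inequality -/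

section ComparisonStd

variable {G : Type*} [GaugeGroup G] {av : ∀ j, Averaging P j G}

/-- **THE FUNCTION (1.77) ON PRINT's DATUM IS POINTWISE AT MOST THE ONE ON READING (b)'s DATUM** (same bond-level solution map; the data `M˙(Q_k^{s*}V_k)` in both domains): fewer
constrained bonds, smaller minimum (`B15DeterminingSetsB.fun177B_lamBondsSeq_le_fun177B_bondsDet_genSet` at `Ω := maxDomT M₁ Z`). [cite: Balaban1989LargeFieldI, (1.77) p.194; Balaban1984PropagatorsII, (2.3) p.224; Balaban1987RG1, (0.1) p.251; Balaban1988Convergent, (2.12)–(2.13) pp.256–257] -/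
theorem fun177stdB_lamDatumP_le_genSetDatumP (bg : DetBackgroundB P G av) (M₁ : ℕ) (Z : Set (Site P 0)) (k : ℕ) (Vk : GaugeField P k G)
    (hVlam : avgFamily av (qsstarGIter0 k Vk) ∈ bg.dom (lamDatumP k (maxDomT M₁ Z)))
    (hVb : avgFamily av (qsstarGIter0 k Vk) ∈ bg.dom (genSetDatumP k (maxDomT M₁ Z))) :
    fun177stdB bg M₁ lamDatumP Z k Vk ≤ fun177stdB bg M₁ genSetDatumP Z k Vk :=
  fun177B_lamBondsSeq_le_fun177B_bondsDet_genSet bg (maxDomT M₁ Z) (qsstarGIter0 k) Vk hVlam hVb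

end ComparisonStd

end Literature.MathematicalPhysics.QuantumFieldTheory.Balaban1983to89.B15Sect1Instances

end
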